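import Summits.BirchSwinnertonDyer.BirchSwinnertonDyer.Theses.PrintCf2
import Summits.BirchSwinnertonDyer.BirchSwinnertonDyer.Theorems.PrintCf2RamifiedOffTYZSelmerRankOneSevenSplit
import HarnessLib

/-!
# Route `PrintCf2`, aside item stmt-BirchSwinnertonDyer-24145 `RamifiedSelmerEightOddOfFactsPlus` — CLOSED BY NAME
# (cell `bsd-print-cf2`, LEAD of crux 20509 g8, line `offtyz-v7`)

The planner's aside DOOR (route rev 45, item 24145, booked «closable BY NAME now») «the minimal-Selmer case of the congruent number
problem at `p = 2` for ALL ODD square-free `n ≡ 5, 7 (mod 8)`, modulo the two printed TYZ facts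
(`tyz_cmPointRingClassFrobeniusData ∧ thm11_parity_of_scriptL`)» is, up to the order of its binders, the `OfFacts` theorem of the LEAD
g7/g8 `MoverAssembly.rankOne_sha_bsdp_two_of_selmerEight_of_facts_odd_all` (`Theorems/PrintCf2RamifiedOffTYZSelmerRankOneSevenSplit.lean`,
p700170; `n ≡ 5`: p694796; `n ≡ 7`: the Monsky-side identity (★)₇ p698773, the mover assembly p699120/p699569 and the split of the
sector p700170).  This file records the closure; it supersedes in scope the `n ≡ 5 (mod 8)` door (item 24096, closed by p700523).
BSD is not proved by any of this; the item closed is a conditional door (its own antecedent names the two prints); the even sector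
`n ≡ 6 (mod 8)` of the `s = 1` stratum is work in progress (`Theorems/PrintCf2RamifiedOffTYZMoverChainsEven.lean` ff.).

References: [cite: TianYuanZhang2017, Thm. 1.1, Thm. 1.2, §3]; [cite: Smith2016CongruentDensity, Thm. 1.4, Thm. 2.2 rows 5, 7(a), 7(b)];
[cite: HeathBrown1994SelmerCongruentII, Appendix (Monsky)]; [cite: Miller2011LMS, Def. 1.1].
-/

noncomputable section

open Literature.NumberTheory.EllipticCurves Literature.NumberTheory.EllipticCurves.TianYuanZhang2017

-- the summit-side convention `Summit.<Summit>.<Problem>.Theorems.<decl>_proof` repeats the problem name (single-problem summit)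
set_option linter.dupNamespace false

namespace Summit.BirchSwinnertonDyer.BirchSwinnertonDyer.Theorems

/-- **Item stmt-BirchSwinnertonDyer-24145 `PrintCf2.RamifiedSelmerEightOddOfFactsPlus`, PROVED** (by name: the LEAD's
`MoverAssembly.rankOne_sha_bsdp_two_of_selmerEight_of_facts_odd_all`): granted `tyz_cmPointRingClassFrobeniusData ∧ thm11_parity_of_scriptL`,
every square-free `n ≡ 5, 7 (mod 8)` with `#Sel₂(E_n) = 8` has `ord_{s=1} L(E_n, s) = rank E_n(ℚ) = 1`, `Ш(E_n)[2^∞] = 0` and `BSD(E_n, 2)`.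
[cite: TianYuanZhang2017, Thm. 1.1, Thm. 1.2 and §3] [cite: Smith2016CongruentDensity, Thm. 1.4] [cite: Miller2011LMS, Def. 1.1] -/
theorem ramifiedSelmerEightOddOfFactsPlus_proof :
    Summit.BirchSwinnertonDyer.BirchSwinnertonDyer.Theses.PrintCf2.RamifiedSelmerEightOddOfFactsPlus :=
  fun h _ hsq h57 hsel =>
    Summit.BirchSwinnertonDyer.PrintCf2.MoverAssembly.rankOne_sha_bsdp_two_of_selmerEight_of_facts_odd_all h.1 h.2 hsq h57 hsel

end Summit.BirchSwinnertonDyer.BirchSwinnertonDyer.Theorems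

end
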